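import Literature.Computability.Cryptography.CubicClassTableLadder
import Literature.Computability.Cryptography.CubicClassTableSpecs
import Literature.Computability.Cryptography.CubicClassTableProgramSpecs
import Literature.NumberTheory.CubicFields.VoronoiCylinderStep
import Literature.NumberTheory.CubicFields.PureCubicIdealCodes
import Literature.NumberTheory.CubicFields.PureCubicWalkParams
import Literature.NumberTheory.NumberFields.PureCubicDiscriminantBound
import HarnessLib

/-!
# Semantics of one step of the class-group table: reduction, clamps, product-and-reduce

Topic `Computability/Cryptography`; theorem-only companion of `CubicClassTable.lean` (crux
`LinnikCubicClassGroups.PureCubicClassGroupFBQP`, line `arakelov-giant-step-cycle`). For the pure cubic field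
`K = ℚ(θ)`, `θ³ = ab²`, a real embedding `σ₁`, a non-real `σ₂`, walk programs `F` meeting `RedSem` (one reduction
step) and `ProdSpec` (lattice product), and an instance `I` with `I.a = a`, `I.b = b`, `I.ord` the code of `𝓞_K`:

* `WalkFns.clampL_eq_self`, `clampL_eq_self_of_one_mem` — the clamp `clampL cap` is silent on a canonical code of an
  over-order `J ∋ 1` with `3 / N(J) ≤ cap` (`den · N(J) ≤ 3`, entries `≤ den`, `PureCubicIdealCodes.lean`); hence on codes
  of REDUCED ideals once `243 a²b² ≤ cap` (`clampL_eq_self_of_reduced`) and on codes of PRODUCTS of two reduced ideals once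
  `(243 a²b²)² ≤ cap` (`clampL_eq_self_of_mul_reduced`);
* `WalkFns.red_sem` — `red` on the canonical code of `J ≠ 0` divides by the cylinder minimum `γ` (a positive relative
  minimum, `N(J) < σ₁ γ ≤ 3 N(J) √|d_K|`), lands on the REDUCED ideal `γ⁻¹ J`, with a certified log;
  `WalkFns.redc_eq_red` — so `redc` never clamps;
* `WalkFns.red_sem_reduced` — on a reduced ideal the reducing element is the Voronoi successor of `1` (the baby step),
  `0 < log σ₁ γ ≤ log (3√|d_K|)`; `WalkFns.red_sem_integral` — on an integral ideal `σ₁ γ > N ≥ 1`;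
* `WalkFns.starCc_sem` — the clamped product-and-reduce of two reduced codes `x ~ B₁`, `y ~ B₂` codes the reduced ideal
  `γ⁻¹ B₁ B₂` at position `x.2 + y.2 + l`, `|l − 2^prec log σ₁ γ| ≤ 1`, `−log |d_K| ≤ log σ₁ γ ≤ log (3 √|d_K|)`.
[Buchmann–Williams 1988, §3; Hallgren 2005, §4]

## References

* J. Buchmann, H. C. Williams, Math. Comp. 50 (1988), §3. [BuchmannWilliams1988]
* S. Hallgren, STOC 2005, §4. [Hallgren2005]
-/

noncomputable section

namespace Literature.Computability.Cryptography

namespace CubicClassTable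

open Literature.NumberTheory.CubicFields Literature.NumberTheory.CubicFields.PureCubicCodes
open Literature.NumberTheory.NumberFields.PureCubic (abs_discr_le ne_zero_of_squarefree_mul)
open scoped NumberField nonZeroDivisors
open NumberField

section Clamp

variable {K : Type*} [Field K] [NumberField K] {a b : ℕ} {θ : K} {σ₁ : K →+* ℝ} {σ₂ : K →+* ℂ}
variable (hdeg : Module.finrank ℚ K = 3) (hσ₂ : ∃ z : K, starRingEnd ℂ (σ₂ z) ≠ σ₂ z)
  (hab : Squarefree (a * b)) (hab1 : a * b ≠ 1) (hθ : θ ^ 3 = ((a * b ^ 2 : ℕ) : K))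

/-- The clamp is silent on a code with denominator and entries in `[0, cap]`. [folklore] -/
theorem WalkFns.clampL_eq_self {cap : ℕ} (dflt : Lat) {c : Lat} (h1 : c.1 ≤ cap)
    (h2 : ∀ h ∈ c.2, 0 ≤ h ∧ h ≤ (cap : ℤ)) : WalkFns.clampL cap dflt c = c := by
  unfold WalkFns.clampL
  rw [if_pos]
  refine ⟨h1, List.all_eq_true.mpr fun h hh => decide_eq_true ?_⟩
  have := h2 h hh
  omega

include hdeg hab hab1 hθ in
/-- **The clamp is silent on the code of an over-order of not too small norm**: `1 ∈ J`, `ν ≤ N(J)`, `3/ν ≤ cap`.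
[cite: Hallgren2005, §4] -/
theorem clampL_eq_self_of_one_mem {c : Lat} (hc : Canon c) {J : FractionalIdeal (𝓞 K)⁰ K}
    (hcJ : ∀ φ : K, Mem θ b c φ ↔ φ ∈ J) (h1 : (1 : K) ∈ J) {ν : ℝ} (hν : 0 < ν)
    (hN : ν ≤ ((FractionalIdeal.absNorm J : ℚ) : ℝ)) {cap : ℕ} (hcap : 3 / ν ≤ (cap : ℝ)) (dflt : Lat) :
    WalkFns.clampL cap dflt c = c := by
  have hden := den_mul_absNorm_le_three hdeg hab hab1 hθ hc hcJ h1
  have hden' : (c.1 : ℝ) ≤ cap := by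
    have h3 : (c.1 : ℝ) * ν ≤ 3 := le_trans (mul_le_mul_of_nonneg_left hN (Nat.cast_nonneg _)) hden
    rw [← le_div_iff₀ hν] at h3
    exact h3.trans hcap
  have hden'' : c.1 ≤ cap := by exact_mod_cast hden'
  refine WalkFns.clampL_eq_self dflt hden'' fun h hh => ?_
  have he := entries_le_of_one_mem hdeg hab hab1 hθ hc hcJ h1 h hh
  exact ⟨he.1, he.2.trans (by exact_mod_cast hden'')⟩

include hdeg hσ₂ hab hab1 hθ in
/-- **The clamp is silent on codes of reduced ideals** (`N ≥ π/(2√|d_K|)`, `6√|d_K|/π ≤ 243 a²b² ≤ cap`).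
[cite: Hallgren2005, §4] -/
theorem clampL_eq_self_of_reduced {c : Lat} (hc : Canon c) {J : FractionalIdeal (𝓞 K)⁰ K}
    (hcJ : ∀ φ : K, Mem θ b c φ ↔ φ ∈ J) (h1 : (1 : K) ∈ posRelMinima σ₁ σ₂ J) {cap : ℕ}
    (hcap : 243 * a ^ 2 * b ^ 2 ≤ cap) (dflt : Lat) : WalkFns.clampL cap dflt c = c := by
  obtain ⟨-, -, hge⟩ := reducedIdeal_bounds hdeg hσ₂ h1
  obtain ⟨ha, hb⟩ := ne_zero_of_squarefree_mul hab
  have hd0 : 0 < |(discr K : ℝ)| := by rw [← Int.cast_abs]; exact_mod_cast abs_pos.mpr (discr_ne_zero K)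
  have hd27 : |(discr K : ℝ)| ≤ 27 * (a : ℝ) ^ 2 * (b : ℝ) ^ 2 := by
    have h := abs_discr_le hdeg hab hab1 hθ
    rw [← Int.cast_abs]; exact_mod_cast h
  obtain ⟨-, -, -, -, hl1, hl2⟩ := walkParams_bounds (prec := 4 * Nat.size (a * b) + 8) ha hb le_rfl hd0 hd27
  have hD0 : 0 < Real.sqrt |(discr K : ℝ)| := Real.sqrt_pos.mpr hd0
  refine clampL_eq_self_of_one_mem hdeg hab hab1 hθ hc hcJ h1.1.1 (by positivity) hge ?_ dflt
  have hcap' : ((243 * a ^ 2 * b ^ 2 : ℕ) : ℝ) ≤ cap := by exact_mod_cast hcap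
  push_cast at hcap'
  calc 3 / (Real.pi / (2 * Real.sqrt |(discr K : ℝ)|)) = 6 * Real.sqrt |(discr K : ℝ)| / Real.pi := by
        field_simp; ring
    _ ≤ _ := hl1
    _ ≤ _ := hl2
    _ ≤ _ := hcap'

include hdeg hσ₂ hab hab1 hθ in
/-- **The clamp is silent on codes of products of two reduced ideals** (`N ≥ π²/(4|d_K|)`, `12|d_K|/π² ≤ (243a²b²)² ≤ cap`).
[cite: Hallgren2005, §4] -/
theorem clampL_eq_self_of_mul_reduced {c : Lat} (hc : Canon c) {B₁ B₂ : FractionalIdeal (𝓞 K)⁰ K}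
    (hcJ : ∀ φ : K, Mem θ b c φ ↔ φ ∈ B₁ * B₂) (h1 : (1 : K) ∈ posRelMinima σ₁ σ₂ B₁)
    (h2 : (1 : K) ∈ posRelMinima σ₁ σ₂ B₂) {cap : ℕ} (hcap : (243 * a ^ 2 * b ^ 2) ^ 2 ≤ cap) (dflt : Lat) :
    WalkFns.clampL cap dflt c = c := by
  obtain ⟨hge, -⟩ := absNorm_mul_reduced_bounds hdeg hσ₂ h1 h2
  have hd0 : 0 < |(discr K : ℝ)| := by rw [← Int.cast_abs]; exact_mod_cast abs_pos.mpr (discr_ne_zero K)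
  have hd27 : |(discr K : ℝ)| ≤ 27 * (a : ℝ) ^ 2 * (b : ℝ) ^ 2 := by
    have h := abs_discr_le hdeg hab hab1 hθ
    rw [← Int.cast_abs]; exact_mod_cast h
  have h11 : (1 : K) ∈ B₁ * B₂ := by simpa using FractionalIdeal.mul_mem_mul h1.1.1 h2.1.1
  refine clampL_eq_self_of_one_mem hdeg hab hab1 hθ hc hcJ h11 (by positivity) hge ?_ dflt
  have hcap' : (((243 * a ^ 2 * b ^ 2) ^ 2 : ℕ) : ℝ) ≤ cap := by exact_mod_cast hcap
  push_cast at hcap'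
  have hpi : 9 < Real.pi ^ 2 := by nlinarith [Real.pi_gt_three]
  have hab0 : (1 : ℝ) ≤ (a : ℝ) ^ 2 * (b : ℝ) ^ 2 := by
    obtain ⟨ha, hb⟩ := ne_zero_of_squarefree_mul hab
    have ha1 : (1 : ℝ) ≤ a := by exact_mod_cast Nat.one_le_iff_ne_zero.mpr ha
    have hb1 : (1 : ℝ) ≤ b := by exact_mod_cast Nat.one_le_iff_ne_zero.mpr hb
    nlinarith [mul_le_mul ha1 hb1 zero_le_one (by linarith)]
  calc 3 / (Real.pi ^ 2 / (4 * |(discr K : ℝ)|)) = 12 * |(discr K : ℝ)| / Real.pi ^ 2 := by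
        field_simp; ring
    _ ≤ 12 * (27 * (a : ℝ) ^ 2 * (b : ℝ) ^ 2) / 9 := by
        rw [div_le_div_iff₀ (by positivity) (by norm_num)]
        nlinarith [mul_nonneg (show (0:ℝ) ≤ 12 by norm_num) hd0.le]
    _ = 36 * ((a : ℝ) ^ 2 * (b : ℝ) ^ 2) := by ring
    _ ≤ (243 * (a : ℝ) ^ 2 * (b : ℝ) ^ 2) ^ 2 := by nlinarith
    _ ≤ cap := hcap'

end Clamp

namespace WalkFns

section Red

variable {K : Type*} [Field K] [NumberField K] {θ : K} {σ₁ : K →+* ℝ} {σ₂ : K →+* ℂ} {F : WalkFns} {I : Inst}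
variable (hdeg : Module.finrank ℚ K = 3) (hσ₂ : ∃ z : K, starRingEnd ℂ (σ₂ z) ≠ σ₂ z)
  (hab : Squarefree (I.a * I.b)) (hab1 : I.a * I.b ≠ 1) (hθ : θ ^ 3 = ((I.a * I.b ^ 2 : ℕ) : K))
  (hred : RedSem F I.a I.b K θ σ₁ σ₂)

include hdeg hσ₂ hred in
/-- **One reduction step, semantically**: on the canonical code `c` of `J ≠ 0`, `F.red I c` divides by the cylinder
minimum `γ ∈ J` — a positive relative minimum with `N(J) < σ₁ γ ≤ 3 N(J) √|d_K|` — the result is the canonical code of the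
REDUCED ideal `γ⁻¹ J`, and the log is certified whenever `σ₁ γ ≥ 2^-prec`. [cite: BuchmannWilliams1988, §3] -/
theorem red_sem {c : Lat} {J : FractionalIdeal (𝓞 K)⁰ K} (hJ : J ≠ 0) (hc : Canon c)
    (hcJ : ∀ φ : K, Mem θ I.b c φ ↔ φ ∈ J) :
    ∃ γ : K, γ ∈ J ∧ 0 < σ₁ γ ∧ ‖σ₂ γ‖ < 1 ∧ (∀ φ : K, φ ∈ J → 0 < σ₁ φ → ‖σ₂ φ‖ < 1 → σ₁ γ ≤ σ₁ φ) ∧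
      γ ∈ posRelMinima σ₁ σ₂ J ∧ ((FractionalIdeal.absNorm J : ℚ) : ℝ) < σ₁ γ ∧
      σ₁ γ ≤ 3 * ((FractionalIdeal.absNorm J : ℚ) : ℝ) * Real.sqrt |(discr K : ℝ)| ∧
      Canon (F.red I c).1 ∧
      (∀ φ : K, Mem θ I.b (F.red I c).1 φ ↔ φ ∈ FractionalIdeal.spanSingleton (𝓞 K)⁰ γ⁻¹ * J) ∧
      (1 : K) ∈ posRelMinima σ₁ σ₂ (FractionalIdeal.spanSingleton (𝓞 K)⁰ γ⁻¹ * J) ∧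
      ((1 : ℝ) / 2 ^ I.prec ≤ σ₁ γ → |((F.red I c).2 : ℝ) - 2 ^ I.prec * Real.log (σ₁ γ)| ≤ 1) := by
  obtain ⟨γ, hγJ, hγpos, hγ1, hγmin, hcan, hmem, hlog⟩ := hred I.prec c J hJ hc hcJ
  obtain ⟨hrel, hlo, hhi⟩ := cylinder_least_bounds hdeg hσ₂ hJ hγJ hγpos hγ1 hγmin
  have hγ0 : γ ≠ 0 := hrel.1.2.1
  refine ⟨γ, hγJ, hγpos, hγ1, hγmin, hrel, hlo, hhi, hcan, fun φ => ?_, one_mem_posRelMinima_inv_mul hrel, hlog⟩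
  change Mem θ I.b (F.redL (I.d, c)).1 φ ↔ _
  rw [show I.d = ((I.a, I.b), I.prec) from rfl, hmem φ, FractionalIdeal.mem_singleton_mul]
  constructor
  · intro h
    exact ⟨φ * γ, h, by rw [mul_comm φ γ, ← mul_assoc, inv_mul_cancel₀ hγ0, one_mul]⟩
  · rintro ⟨y, hy, rfl⟩
    rwa [mul_comm γ⁻¹ y, inv_mul_cancel_right₀ hγ0]

include hdeg hσ₂ hab hab1 hθ hred in
/-- **`redc` never clamps** (on the canonical code of a nonzero ideal, `243 a²b² ≤ cap`). [cite: Hallgren2005, §4] -/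
theorem redc_eq_red (hord : I.ord = I.ord) {cap : ℕ} (hcap : 243 * I.a ^ 2 * I.b ^ 2 ≤ cap) {c : Lat}
    {J : FractionalIdeal (𝓞 K)⁰ K} (hJ : J ≠ 0) (hc : Canon c) (hcJ : ∀ φ : K, Mem θ I.b c φ ↔ φ ∈ J) :
    F.redc I cap c = F.red I c := by
  have _ := hord
  obtain ⟨γ, -, -, -, -, -, -, -, hcan, hmem, h1, -⟩ := red_sem hdeg hσ₂ hred hJ hc hcJ
  unfold redc
  rw [clampL_eq_self_of_reduced hdeg hσ₂ hab hab1 hθ hcan hmem h1 hcap]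

variable (ε : (𝓞 K)ˣ) (hε : 1 < σ₁ (algebraMap (𝓞 K) K ε))

include hdeg hσ₂ hred hε in
/-- **Reduction of a reduced ideal is the baby step**: the reducing element is `γ = voronoiSucc J 1`, with
`1 < σ₁ γ ≤ 3 √|d_K|` (so `0 < log σ₁ γ ≤ log (3√|d_K|)` and the log is certified). [cite: BuchmannWilliams1988, §3] -/
theorem red_sem_reduced {c : Lat} {J : FractionalIdeal (𝓞 K)⁰ K} (hc : Canon c)
    (hcJ : ∀ φ : K, Mem θ I.b c φ ↔ φ ∈ J) (h1 : (1 : K) ∈ posRelMinima σ₁ σ₂ J) :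
    Canon (F.red I c).1 ∧
      (∀ φ : K, Mem θ I.b (F.red I c).1 φ ↔
        φ ∈ FractionalIdeal.spanSingleton (𝓞 K)⁰ (voronoiSucc σ₁ σ₂ J 1)⁻¹ * J) ∧
      (1 : K) ∈ posRelMinima σ₁ σ₂ (FractionalIdeal.spanSingleton (𝓞 K)⁰ (voronoiSucc σ₁ σ₂ J 1)⁻¹ * J) ∧
      1 < σ₁ (voronoiSucc σ₁ σ₂ J 1) ∧ σ₁ (voronoiSucc σ₁ σ₂ J 1) ≤ 3 * Real.sqrt |(discr K : ℝ)| ∧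
      0 < Real.log (σ₁ (voronoiSucc σ₁ σ₂ J 1)) ∧
      Real.log (σ₁ (voronoiSucc σ₁ σ₂ J 1)) ≤ Real.log (3 * Real.sqrt |(discr K : ℝ)|) ∧
      |((F.red I c).2 : ℝ) - 2 ^ I.prec * Real.log (σ₁ (voronoiSucc σ₁ σ₂ J 1))| ≤ 1 := by
  have hJ : J ≠ 0 := fun h => one_ne_zero ((FractionalIdeal.mem_zero_iff (𝓞 K)⁰).mp (h ▸ h1.1.1))
  obtain ⟨γ, hγJ, hγpos, hγ1, hγmin, hrel, -, -, hcan, hmem, hone, hlog⟩ := red_sem hdeg hσ₂ hred hJ hc hcJ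
  obtain ⟨hsJ, hspos, hs1, hsmin⟩ := voronoiSucc_one_mem_cylinder hdeg hσ₂ ε hε h1
  have hγs : γ = voronoiSucc σ₁ σ₂ J 1 :=
    σ₁.injective (le_antisymm (hγmin _ hsJ hspos hs1) (hsmin γ hγJ hγpos hγ1))
  subst hγs
  obtain ⟨-, hlt, -⟩ := voronoiSucc_spec hdeg hσ₂ ε hε h1
  rw [map_one] at hlt
  have hle : σ₁ (voronoiSucc σ₁ σ₂ J 1) ≤ 3 * Real.sqrt |(discr K : ℝ)| := by
    have h := voronoiSucc_le_mul hdeg hσ₂ ε hε h1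
    rwa [map_one, mul_one] at h
  have hprec : (1 : ℝ) / 2 ^ I.prec ≤ σ₁ (voronoiSucc σ₁ σ₂ J 1) := by
    have : (1 : ℝ) / 2 ^ I.prec ≤ 1 := by
      rw [div_le_one (by positivity)]; exact one_le_pow₀ (by norm_num)
    linarith
  exact ⟨hcan, hmem, hone, hlt, hle, Real.log_pos hlt, Real.log_le_log hspos hle, hlog hprec⟩

include hdeg hσ₂ hred in
/-- **Reduction of a nonzero integral ideal** `𝔞` (as a fractional ideal): the reducing element has
`N(𝔞) < σ₁ γ ≤ 3 N(𝔞) √|d_K|`, in particular `σ₁ γ > 1` and the log is certified. [cite: BuchmannWilliams1988, §3] -/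
theorem red_sem_integral {c : Lat} {A : Ideal (𝓞 K)} (hA : A ≠ ⊥) (hc : Canon c)
    (hcA : ∀ φ : K, Mem θ I.b c φ ↔ φ ∈ (A : FractionalIdeal (𝓞 K)⁰ K)) :
    ∃ γ : K, γ ∈ posRelMinima σ₁ σ₂ (A : FractionalIdeal (𝓞 K)⁰ K) ∧
      (Ideal.absNorm A : ℝ) < σ₁ γ ∧ σ₁ γ ≤ 3 * (Ideal.absNorm A : ℝ) * Real.sqrt |(discr K : ℝ)| ∧ 1 < σ₁ γ ∧
      Canon (F.red I c).1 ∧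
      (∀ φ : K, Mem θ I.b (F.red I c).1 φ ↔ φ ∈ FractionalIdeal.spanSingleton (𝓞 K)⁰ γ⁻¹ * (A : FractionalIdeal (𝓞 K)⁰ K)) ∧
      (1 : K) ∈ posRelMinima σ₁ σ₂ (FractionalIdeal.spanSingleton (𝓞 K)⁰ γ⁻¹ * (A : FractionalIdeal (𝓞 K)⁰ K)) ∧
      |((F.red I c).2 : ℝ) - 2 ^ I.prec * Real.log (σ₁ γ)| ≤ 1 := by
  have hJ : (A : FractionalIdeal (𝓞 K)⁰ K) ≠ 0 := FractionalIdeal.coeIdeal_ne_zero.mpr hA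
  obtain ⟨γ, -, -, -, -, hrel, hlo, hhi, hcan, hmem, hone, hlog⟩ := red_sem hdeg hσ₂ hred hJ hc hcA
  rw [FractionalIdeal.coeIdeal_absNorm, Rat.cast_natCast] at hlo hhi
  have hN1 : (1 : ℝ) ≤ (Ideal.absNorm A : ℝ) := by
    exact_mod_cast Nat.one_le_iff_ne_zero.mpr (by rw [Ne, Ideal.absNorm_eq_zero_iff]; exact hA)
  have h1 : 1 < σ₁ γ := lt_of_le_of_lt hN1 hlo
  have hprec : (1 : ℝ) / 2 ^ I.prec ≤ σ₁ γ := by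
    have : (1 : ℝ) / 2 ^ I.prec ≤ 1 := by
      rw [div_le_one (by positivity)]; exact one_le_pow₀ (by norm_num)
    linarith
  exact ⟨γ, hrel, hlo, hhi, h1, hcan, hmem, hone, hlog hprec⟩

end Red

section Star

variable {K : Type*} [Field K] [NumberField K] {θ : K} {σ₁ : K →+* ℝ} {σ₂ : K →+* ℂ} {F : WalkFns} {I : Inst}
variable (hdeg : Module.finrank ℚ K = 3) (hσ₂ : ∃ z : K, starRingEnd ℂ (σ₂ z) ≠ σ₂ z)
  (hab : Squarefree (I.a * I.b)) (hab1 : I.a * I.b ≠ 1) (hθ : θ ^ 3 = ((I.a * I.b ^ 2 : ℕ) : K))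
  (hred : RedSem F I.a I.b K θ σ₁ σ₂) (hprod : ProdSpec I.a I.b K θ F.latProd)

omit [NumberField K] in
include hprod in
/-- **The lattice product codes the product ideal.** [cite: Hallgren2005, §4] -/
theorem latProd_sem {c₁ c₂ : Lat} {B₁ B₂ : FractionalIdeal (𝓞 K)⁰ K} (hc₁ : Canon c₁) (hc₂ : Canon c₂)
    (h₁ : ∀ φ : K, Mem θ I.b c₁ φ ↔ φ ∈ B₁) (h₂ : ∀ φ : K, Mem θ I.b c₂ φ ↔ φ ∈ B₂) :
    Canon (F.latProd ((I.a, I.b), (c₁, c₂))) ∧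
      ∀ φ : K, Mem θ I.b (F.latProd ((I.a, I.b), (c₁, c₂))) φ ↔ φ ∈ B₁ * B₂ := by
  obtain ⟨hcan, hmem⟩ := hprod c₁ c₂ hc₁ hc₂
  refine ⟨hcan, fun φ => ?_⟩
  rw [hmem, mem_mul_iff_mem_closure]
  simp_rw [h₁, h₂]

include hdeg hσ₂ hab hab1 hθ hred hprod in
/-- **The clamped product-and-reduce of two reduced codes.** If `x.1 ~ B₁`, `y.1 ~ B₂` (canonical codes of reduced
ideals) and `(243a²b²)² ≤ cap`, then `starCc x y` codes the reduced ideal `γ⁻¹ B₁ B₂` (`γ` the cylinder minimum of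
`B₁ B₂`, a positive relative minimum) at position `x.2 + y.2 + l` with `|l − 2^prec log σ₁ γ| ≤ 1` and
`−log |d_K| ≤ log σ₁ γ ≤ log (3√|d_K|)`. [cite: BuchmannWilliams1988, §3] -/
theorem starCc_sem {cap : ℕ} (hcap : (243 * I.a ^ 2 * I.b ^ 2) ^ 2 ≤ cap)
    (hprec : 4 * Nat.size (I.a * I.b) + 8 ≤ I.prec) {x y : PLat} {B₁ B₂ : FractionalIdeal (𝓞 K)⁰ K}
    (hx : Canon x.1) (hxB : ∀ φ : K, Mem θ I.b x.1 φ ↔ φ ∈ B₁) (h1 : (1 : K) ∈ posRelMinima σ₁ σ₂ B₁)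
    (hy : Canon y.1) (hyB : ∀ φ : K, Mem θ I.b y.1 φ ↔ φ ∈ B₂) (h2 : (1 : K) ∈ posRelMinima σ₁ σ₂ B₂) :
    ∃ γ : K, γ ∈ posRelMinima σ₁ σ₂ (B₁ * B₂) ∧
      Canon (F.starCc I cap x y).1 ∧
      (∀ φ : K, Mem θ I.b (F.starCc I cap x y).1 φ ↔ φ ∈ FractionalIdeal.spanSingleton (𝓞 K)⁰ γ⁻¹ * (B₁ * B₂)) ∧
      (1 : K) ∈ posRelMinima σ₁ σ₂ (FractionalIdeal.spanSingleton (𝓞 K)⁰ γ⁻¹ * (B₁ * B₂)) ∧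
      |(((F.starCc I cap x y).2 - x.2 - y.2 : ℤ) : ℝ) - 2 ^ I.prec * Real.log (σ₁ γ)| ≤ 1 ∧
      -Real.log |(discr K : ℝ)| ≤ Real.log (σ₁ γ) ∧ Real.log (σ₁ γ) ≤ Real.log (3 * Real.sqrt |(discr K : ℝ)|) ∧
      1 / |(discr K : ℝ)| < σ₁ γ := by
  obtain ⟨hcanP, hmemP⟩ := latProd_sem hprod hx hy hxB hyB
  have hcap1 : 243 * I.a ^ 2 * I.b ^ 2 ≤ cap := le_trans (Nat.le_self_pow two_ne_zero _) hcap
  have hclamp : WalkFns.clampL cap I.ord (F.latProd ((I.a, I.b), (x.1, y.1))) = F.latProd ((I.a, I.b), (x.1, y.1)) :=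
    clampL_eq_self_of_mul_reduced hdeg hσ₂ hab hab1 hθ hcanP hmemP h1 h2 hcap I.ord
  have hM0 : B₁ * B₂ ≠ 0 := by
    have h11 : (1 : K) ∈ B₁ * B₂ := by simpa using FractionalIdeal.mul_mem_mul h1.1.1 h2.1.1
    exact fun h => one_ne_zero ((FractionalIdeal.mem_zero_iff (𝓞 K)⁰).mp (h ▸ h11))
  have hredc : F.redc I cap (F.latProd ((I.a, I.b), (x.1, y.1))) = F.red I (F.latProd ((I.a, I.b), (x.1, y.1))) :=
    redc_eq_red hdeg hσ₂ hab hab1 hθ hred rfl hcap1 hM0 hcanP hmemP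
  obtain ⟨γ, -, hγpos, -, -, hrel, hlo, hhi, hcan, hmem, hone, hlog⟩ := red_sem hdeg hσ₂ hred hM0 hcanP hmemP
  obtain ⟨hN, hN1⟩ := absNorm_mul_reduced_bounds hdeg hσ₂ h1 h2
  obtain ⟨hlog1, hlog2, hinv⟩ := log_cylinderMin_bounds hdeg hσ₂ hN hN1 hlo hhi
  -- `σ₁ γ ≥ 1/|d| ≥ 2^-prec`
  obtain ⟨ha, hb⟩ := ne_zero_of_squarefree_mul hab
  have hd0 : 0 < |(discr K : ℝ)| := by rw [← Int.cast_abs]; exact_mod_cast abs_pos.mpr (discr_ne_zero K)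
  have hd27 : |(discr K : ℝ)| ≤ 27 * (I.a : ℝ) ^ 2 * (I.b : ℝ) ^ 2 := by
    have h := abs_discr_le hdeg hab hab1 hθ
    rw [← Int.cast_abs]; exact_mod_cast h
  obtain ⟨-, hdp, -⟩ := walkParams_bounds ha hb hprec hd0 hd27
  have hcert : (1 : ℝ) / 2 ^ I.prec ≤ σ₁ γ :=
    le_trans (one_div_le_one_div_of_le hd0 hdp) hinv.le
  have hpos_eq : (F.starCc I cap x y).2 - x.2 - y.2 = (F.red I (F.latProd ((I.a, I.b), (x.1, y.1)))).2 := by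
    unfold starCc; rw [hclamp, hredc]; ring
  have hfst_eq : (F.starCc I cap x y).1 = (F.red I (F.latProd ((I.a, I.b), (x.1, y.1)))).1 := by
    unfold starCc; rw [hclamp, hredc]
  refine ⟨γ, hrel, hfst_eq ▸ hcan, fun φ => by rw [hfst_eq]; exact hmem φ, hone, ?_, hlog1, hlog2, hinv⟩
  rw [hpos_eq]; exact hlog hcert

end Star

end WalkFns


section Summary

/-- **Summary (registered helper of the class-group stage)**: the clamped product-and-reduce of two reduced codes codes the
reduced ideal `γ⁻¹ B₁ B₂` with a certified, bounded log. [cite: BuchmannWilliams1988, §3] -/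
theorem cubicClassTable_starCc_sem : ∀ (K : Type) [Field K] [NumberField K], Module.finrank ℚ K = 3 → ∀ (θ : K) (σ₁ : K →+* ℝ) (σ₂ : K →+* ℂ), (∃ z : K, starRingEnd ℂ (σ₂ z) ≠ σ₂ z) → ∀ (F : CubicClassTable.WalkFns) (I : CubicClassTable.Inst), Squarefree (I.a * I.b) → I.a * I.b ≠ 1 → θ ^ 3 = ((I.a * I.b ^ 2 : ℕ) : K) → CubicClassTable.RedSem F I.a I.b K θ σ₁ σ₂ → CubicClassTable.ProdSpec I.a I.b K θ F.latProd → ∀ (cap : ℕ), (243 * I.a ^ 2 * I.b ^ 2) ^ 2 ≤ cap → 4 * Nat.size (I.a * I.b) + 8 ≤ I.prec → ∀ (x y : (ℕ × List ℤ) × ℤ) (B₁ B₂ : FractionalIdeal (𝓞 K)⁰ K), PureCubicCodes.Canon x.1 → (∀ φ : K, PureCubicCodes.Mem θ I.b x.1 φ ↔ φ ∈ B₁) → (1 : K) ∈ posRelMinima σ₁ σ₂ B₁ → PureCubicCodes.Canon y.1 → (∀ φ : K, PureCubicCodes.Mem θ I.b y.1 φ ↔ φ ∈ B₂) → (1 :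 K) ∈ posRelMinima σ₁ σ₂ B₂ → ∃ γ : K, γ ∈ posRelMinima σ₁ σ₂ (B₁ * B₂) ∧ PureCubicCodes.Canon (F.starCc I cap x y).1 ∧ (∀ φ : K, PureCubicCodes.Mem θ I.b (F.starCc I cap x y).1 φ ↔ φ ∈ FractionalIdeal.spanSingleton (𝓞 K)⁰ γ⁻¹ * (B₁ * B₂)) ∧ (1 : K) ∈ posRelMinima σ₁ σ₂ (FractionalIdeal.spanSingleton (𝓞 K)⁰ γ⁻¹ * (B₁ * B₂)) ∧ |(((F.starCc I cap x y).2 - x.2 - y.2 : ℤ) : ℝ) - 2 ^ I.prec * Real.log (σ₁ γ)| ≤ 1 ∧ -Real.log |(NumberField.discr K : ℝ)| ≤ Real.log (σ₁ γ) ∧ Real.log (σ₁ γ) ≤ Real.log (3 * Real.sqrt |(NumberField.discr K : ℝ)|) ∧ 1 / |(NumberField.discr K : ℝ)| < σ₁ γ :=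
  fun _ _ _ hdeg _ _ _ hσ₂ _ _ hab hab1 hθ hred hprod _ hcap hprec _ _ _ _ hx hxB h1 hy hyB h2 =>
    WalkFns.starCc_sem hdeg hσ₂ hab hab1 hθ hred hprod hcap hprec hx hxB h1 hy hyB h2

end Summary

end CubicClassTable

end Literature.Computability.Cryptography
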